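import Literature.AnabelianGeometry.AbsoluteAnabelian.AbsTopIProp410Sub
import HarnessLib

/-!
# [AbsTopI] Prop 4.10 (iii): print-faithful replacement rows for iii.L03 / iii.L05 of the
# statements-first sub-DAG (`AbsTopIProp410Sub.lean`)

S. Mochizuki, *Topics in Absolute Anabelian Geometry I: Generalities* [AbsTopI] (J. Math. Sci.
Univ. Tokyo 19 (2012)), manuscript pagination (lit key `paper:url-11ac98ba15fc`), read on the page
(§0 p. 8; Prop 4.10 (iii) p. 60 l. 40–52; Def 4.11 (i)(c) pp. 62–63), and the abc-iut cell's audit of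
the sub-DAG `AbsTopIProp410Sub.lean` (abc-iut-w5-d025, p414417; finding F-w5d011-1 of
abc-iut-w5-d011 2026-08-26T01:50:25Z; L4-lead RULINGS #3 (4) 2026-08-26T01:54:15Z):

* Row iii.L03 `DeCuspidalization.Surjective` ("`f` surjective and `f(Δ^tp_X) = Δ^tp_Y`") quotes
  Def 4.2 (iii)(c) p. 50, which is the PROFINITE clause "a surjection of profinite groups
  `φ : Π_j ↠ Π_{j+1}`" — already the field `fHat_surjective`.  The TEMPERED clause is Def 4.11 (i)(c)
  pp. 62–63: "a dense homomorphism `φ : Π_j → Π_{j+1}` which is isomorphic to the co-free completion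
  of `Π_j` with respect to the induced profinite quotient `φ̂ : Π̂_j ↠ Π̂_{j+1}`".  The printed
  property of the tempered `f` is therefore DENSITY: `DeCuspidalization.Dense` below (and it is a
  CONSEQUENCE of the node `Prop410iii` at any kit with dense `η`: `Prop410iii.denseRange_f`,
  `AbsTopIProp410DenseProofs.lean`).  Surjectivity of `f` is not printed; it is not added.
* Row iii.L05 `CoFreeCofinalAlong`, conjunct 1 (PREIMAGE cofinality: every X-index contains
  `f⁻¹(H′)` for some Y-index `H′`) is SUSPECT-TOO-STRONG at the intended data (F-w5d011-1:
  `f⁻¹(H′) ⊇ Ker f ∩ Δ^tp_X ⊇ I_x`, while e.g. `H := Ker(Δ^tp_X → H₁(Δ^tp_X, ℤ/l))` is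
  characteristic, open, of finite index and omits `I_x`).  §0 p. 8 compares the two inverse systems
  through their IMAGES in `Q = Π̂_Y`: the typed replacement `CoFreeKernelCofinalAlong` asks, for every
  Y-index `H′`, for an X-index `H` whose kernel-image `closure(f̂(Ĥ^{co-fr}))` lies in
  `Ĥ′^{co-fr} ⊆ Π̂_Y` — the direction that DEFINES the comparison map
  `(Π^tp_X)^{Π̂_Y/co-fr} → lim_{H′} Π̂_Y/Ĥ′^{co-fr}`; it is PROVED here from row iii.L04
  (`CoFreeCompatAlong`), monotonicity of `H ↦ H^{co-fr}` (row iii.L05 conjunct 2, a theorem at the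
  construction: `cofreeCore_mono`) and the cofinality of characteristic open subgroups of finite
  index in `Δ^tp_X` (`CharOpenCofinal`, the tacit input of §0's "`H ⊆ Δ` ranges over the
  characteristic open subgroups of `Δ` of finite index").  The CONVERSE comparison
  (`CoFreeKernelCofinalAlongConverse`) is typed separately and labelled OURS/UNVERIFIED: print proves
  (iii) "immediately from (i)" (p. 61) and states no cofinality.  (abc-iut-L4-t13 gen 3's
  `AbsTopIProp410CoFreeBridge.lean` states the MUTUAL form at the construction as one conjunction
  `CoFreeCofinalImAlong E`; the kit-level rows here keep the two directions apart so that only the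
  proved direction is ever consumed.)

Nothing is asserted about the nodes: new rows are named `Prop`s; the only theorems are reductions.
HONEST FRAMING: refereed prerequisite paper; no bearing on [IUTchIII] Cor 3.12; typed ≠ proved.
-/

noncomputable section

open Topology

namespace Literature.AnabelianGeometry.AbsoluteAnabelian.AbsTopI.Prop410

open Literature.AnabelianGeometry.SemiGraphs

variable {p : ℕ} [Fact p.Prime]

/-! ### Row iii.L03, tempered form: `f` is dense (Def 4.11 (i)(c)) -/

/-- ROW iii.L03′ (replaces the surjectivity reading of iii.L03): the tempered homomorphism
`f : Π^tp_X → Π^tp_Y` of a de-cuspidalization is DENSE — [AbsTopI] Def 4.11 (i)(c) pp. 62–63 "Type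
`•`: [...] consists of a dense homomorphism `φ : Π_j → Π_{j+1}` which is isomorphic to the co-free
completion of `Π_j` with respect to the induced profinite quotient `φ̂ : Π̂_j ↠ Π̂_{j+1}`".  (At any
kit with dense `η` this FOLLOWS from `Prop410iii`: `Prop410iii.denseRange_f`.)
[cite: MochizukiAbsTopI2012, Def 4.11 (i)(c) p.62] -/
def DeCuspidalization.Dense {X Y : TemperedCurve p} (E : DeCuspidalization X Y) : Prop :=
  DenseRange E.f

/-! ### The restriction of `f` to `Δ^tp` and preimages of Y-indices -/

namespace DeCuspidalization

variable {X Y : TemperedCurve p} (E : DeCuspidalization X Y)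

/-- `f` maps `Δ^tp_X = Ker(Π^tp_X → G)` into `Δ^tp_Y` (it lies over `G_k`: field `aug_comp`).
[cite: MochizukiAbsTopI2012, Prop 4.10 (iii) p.60] -/
theorem map_mem_deltaTemp {g : X.PiTemp} (hg : g ∈ X.DeltaTemp) : E.f g ∈ Y.DeltaTemp := by
  rw [TemperedCurve.DeltaTemp, MonoidHom.mem_ker] at hg ⊢
  change Y.aug (E.f g) = 1
  rw [E.aug_comp g]
  exact hg

/-- `f⁻¹(Δ^tp_Y) = Δ^tp_X` (both are the kernel of the augmentation to `G_k`).
[cite: MochizukiAbsTopI2012, Prop 4.10 (iii) p.60] -/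
theorem comap_deltaTemp : Y.DeltaTemp.comap E.f.toMonoidHom = X.DeltaTemp := by
  ext g
  rw [Subgroup.mem_comap, TemperedCurve.DeltaTemp, TemperedCurve.DeltaTemp, MonoidHom.mem_ker,
    MonoidHom.mem_ker]
  change Y.aug (E.f g) = 1 ↔ X.aug g = 1
  rw [E.aug_comp g]

/-- The preimage of a subgroup of `Δ^tp_Y` lies in `Δ^tp_X`. [cite: MochizukiAbsTopI2012, Prop 4.10 (iii) p.60] -/
theorem comap_le_deltaTemp {H' : Subgroup Y.PiTemp} (h : H' ≤ Y.DeltaTemp) :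
    H'.comap E.f.toMonoidHom ≤ X.DeltaTemp := by
  rw [← E.comap_deltaTemp]
  exact Subgroup.comap_mono h

/-- `Δ^tp_X → Δ^tp_Y`, the restriction of `f` ("respectively, `Δ^tp_X → Δ^tp_Y`", Prop 4.10 (iii)
p. 60). [cite: MochizukiAbsTopI2012, Prop 4.10 (iii) p.60] -/
def fDelta : X.DeltaTemp →ₜ* Y.DeltaTemp where
  toFun g := ⟨E.f (g : X.PiTemp), E.map_mem_deltaTemp g.2⟩
  map_one' := Subtype.ext (map_one E.f)
  map_mul' a b := Subtype.ext (map_mul E.f (a : X.PiTemp) (b : X.PiTemp))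
  continuous_toFun := (E.f.continuous.comp continuous_subtype_val).subtype_mk _

/-- Formula for `Δ^tp_X → Δ^tp_Y`. [cite: MochizukiAbsTopI2012, Prop 4.10 (iii) p.60] -/
@[simp] theorem coe_fDelta_apply (g : X.DeltaTemp) : ((E.fDelta g : Y.DeltaTemp) : Y.PiTemp) = E.f g :=
  rfl

/-- Inside `Δ^tp`, the preimage `f⁻¹(H′)` is the preimage under `Δ^tp_X → Δ^tp_Y`.
[cite: MochizukiAbsTopI2012, Prop 4.10 (iii) p.60] -/
theorem subgroupOf_comap (H' : Subgroup Y.PiTemp) :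
    (H'.comap E.f.toMonoidHom).subgroupOf X.DeltaTemp =
      (H'.subgroupOf Y.DeltaTemp).comap E.fDelta.toMonoidHom := by
  ext g
  simp only [Subgroup.mem_subgroupOf, Subgroup.mem_comap]
  rfl

/-- **The preimage of a Y-side open finite-index subgroup of `Δ^tp_Y` is an open finite-index
subgroup of `Δ^tp_X`** (continuity of `f` and functoriality of the index).
[cite: MochizukiAbsTopI2012, Prop 4.10 (iii) p.60] -/
theorem isOpenFiniteIndexInDelta_comap {H' : Subgroup Y.PiTemp} (h : IsOpenFiniteIndexInDelta Y H') :
    IsOpenFiniteIndexInDelta X (H'.comap E.f.toMonoidHom) := by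
  obtain ⟨hle, hopen, hfi⟩ := h
  refine ⟨E.comap_le_deltaTemp hle, ?_, ?_⟩
  · rw [E.subgroupOf_comap, Subgroup.coe_comap]
    exact hopen.preimage E.fDelta.continuous
  · rw [E.subgroupOf_comap]
    haveI := hfi
    constructor
    rw [Subgroup.index_comap]
    exact Subgroup.FiniteIndex.index_ne_zero

/-- `toHat_Y ∘ f = f̂ ∘ toHat_X` as homomorphisms (field `toHat_comp`).
[cite: MochizukiAbsTopI2012, Prop 4.10 (iii) p.60] -/
theorem toHat_comp_eq :
    Y.toHat.toMonoidHom.comp E.f.toMonoidHom = E.fHat.toMonoidHom.comp X.toHat.toMonoidHom :=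
  MonoidHom.ext fun g => E.toHat_comp g

end DeCuspidalization

/-! ### Row iii.L05, image form (§0 p. 8: comparison inside `Q = Π̂_Y`) -/

/-- The image in `Q = Π̂_Y` of the X-side kernel attached to `H ⊆ Δ^tp_X`: the closure of
`f̂(toHat_X(H^{co-fr}))` — "`Ĥ^{co-fr}_Q ⊆ Q` is the image of `Ĥ^{co-fr}` in `Q`" ([AbsTopI] §0 p. 8)
for `Q := Π̂_Y`. [cite: MochizukiAbsTopI2012, §0 p.8] -/
def imKernelX {X Y : TemperedCurve p} (E : DeCuspidalization X Y) (kitX : CoFreeQKit X Y.PiHat E.fHat)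
    (H : Subgroup X.PiTemp) : Subgroup Y.PiHat :=
  ((kitX.coFr H).map (E.fHat.toMonoidHom.comp X.toHat.toMonoidHom)).topologicalClosure

/-- The Y-side kernel attached to `H′ ⊆ Δ^tp_Y`: `Ĥ′^{co-fr} ⊆ Π̂_Y`, the closure of
`toHat_Y(H′^{co-fr})` ([AbsTopI] §0 p. 8 with `Q := Π̂_Y`, `Π := Π^tp_Y`). [cite: MochizukiAbsTopI2012, §0 p.8] -/
def imKernelY {Y : TemperedCurve p} (kitY : CoFreeQKit Y Y.PiHat (ContinuousMonoidHom.id Y.PiHat))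
    (H' : Subgroup Y.PiTemp) : Subgroup Y.PiHat :=
  ((kitY.coFr H').map Y.toHat.toMonoidHom).topologicalClosure

/-- ROW iii.L05′ (image form, replaces conjunct 1 of `CoFreeCofinalAlong`; OUR reconstruction of
"(iii) follows immediately from (i)", p. 61): for every Y-index `H′` (characteristic open of finite
index in `Δ^tp_Y`) there is an X-index `H` with `closure(f̂(Ĥ^{co-fr})) ⊆ Ĥ′^{co-fr}` in `Π̂_Y` — so
that every coordinate `Π̂_Y/Ĥ′^{co-fr}` of the Y-side limit receives a map from the X-side limit
`lim_H Im(Π^tp_X → Π̂_Y/closure f̂(Ĥ^{co-fr}))`.  PROVED from iii.L04 + monotonicity +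
`CharOpenCofinal` in `coFreeKernelCofinalAlong_of`. [cite: MochizukiAbsTopI2012, §0 p.8] -/
def CoFreeKernelCofinalAlong {X Y : TemperedCurve p} (E : DeCuspidalization X Y)
    (kitX : CoFreeQKit X Y.PiHat E.fHat)
    (kitY : CoFreeQKit Y Y.PiHat (ContinuousMonoidHom.id Y.PiHat)) : Prop :=
  ∀ H' : Subgroup Y.PiTemp, IsCharOpenFiniteIndexInDelta Y H' →
    ∃ H : Subgroup X.PiTemp, IsCharOpenFiniteIndexInDelta X H ∧ imKernelX E kitX H ≤ imKernelY kitY H'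

/-- The CONVERSE comparison (OURS, UNVERIFIED at the intended data — print states no cofinality;
typed so that it can be audited or refuted, consumed by NO theorem as a hypothesis): for every
X-index `H` some Y-index `H′` with `Ĥ′^{co-fr} ⊆ closure(f̂(Ĥ^{co-fr}))`.
[cite: MochizukiAbsTopI2012, §0 p.8] -/
def CoFreeKernelCofinalAlongConverse {X Y : TemperedCurve p} (E : DeCuspidalization X Y)
    (kitX : CoFreeQKit X Y.PiHat E.fHat)
    (kitY : CoFreeQKit Y Y.PiHat (ContinuousMonoidHom.id Y.PiHat)) : Prop :=
  ∀ H : Subgroup X.PiTemp, IsCharOpenFiniteIndexInDelta X H →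
    ∃ H' : Subgroup Y.PiTemp, IsCharOpenFiniteIndexInDelta Y H' ∧ imKernelY kitY H' ≤ imKernelX E kitX H

/-- The tacit input of [AbsTopI] §0 p. 8 ("`H ⊆ Δ` ranges over the characteristic open subgroups of
`Δ` of finite index" — for the limit over them to see all of `Δ`): characteristic open subgroups of
finite index are COFINAL among open subgroups of finite index of `Δ^tp_X`.  Named input (holds e.g.
when `Δ̂^tp_X` is topologically finitely generated; not derivable from the bare interface).
[cite: MochizukiAbsTopI2012, §0 p.8] -/
def CharOpenCofinal (X : TemperedCurve p) : Prop :=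
  ∀ U : Subgroup X.PiTemp, IsOpenFiniteIndexInDelta X U →
    ∃ H : Subgroup X.PiTemp, IsCharOpenFiniteIndexInDelta X H ∧ H ≤ U

/-- Monotonicity of `H ↦ H^{co-fr}` on open finite-index subgroups of `Δ^tp_X` (conjunct 2 of row
iii.L05 `CoFreeCofinalAlong`; a THEOREM at the construction: `cofreeCore_mono`, Nielsen–Schreier).
[cite: MochizukiAbsTopI2012, §0 p.8] -/
def CoFreeQKit.Monotone {X : TemperedCurve p} {Q : Type} [Group Q] [TopologicalSpace Q]
    {q : X.PiHat →ₜ* Q} (kit : CoFreeQKit X Q q) : Prop :=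
  ∀ H₁ H₂ : Subgroup X.PiTemp, IsOpenFiniteIndexInDelta X H₁ → IsOpenFiniteIndexInDelta X H₂ →
    H₁ ≤ H₂ → kit.coFr H₁ ≤ kit.coFr H₂

/-- Conjunct 2 of `CoFreeCofinalAlong` is `CoFreeQKit.Monotone`. [cite: MochizukiAbsTopI2012, §0 p.8] -/
theorem CoFreeCofinalAlong.monotone {X Y : TemperedCurve p} {E : DeCuspidalization X Y}
    {kitX : CoFreeQKit X Y.PiHat E.fHat} (h : CoFreeCofinalAlong E kitX) : kitX.Monotone :=
  h.2

/-- **Row iii.L05′ REDUCED**: `CoFreeCompatAlong` (iii.L04: `f(f⁻¹(H′)^{co-fr}) = H′^{co-fr}`) +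
monotonicity of `H ↦ H^{co-fr}` + `CharOpenCofinal X` ⟹ `CoFreeKernelCofinalAlong`.  Proof: for a
Y-index `H′`, `f⁻¹(H′)` is open of finite index in `Δ^tp_X`; choose a characteristic `H ⊆ f⁻¹(H′)`;
then `f̂(toHat_X(H^{co-fr})) = toHat_Y(f(H^{co-fr})) ⊆ toHat_Y(f(f⁻¹(H′)^{co-fr})) =
toHat_Y(H′^{co-fr})`, and take closures. [cite: MochizukiAbsTopI2012, §0 p.8] -/
theorem coFreeKernelCofinalAlong_of {X Y : TemperedCurve p} {E : DeCuspidalization X Y}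
    {kitX : CoFreeQKit X Y.PiHat E.fHat}
    {kitY : CoFreeQKit Y Y.PiHat (ContinuousMonoidHom.id Y.PiHat)}
    (hcompat : CoFreeCompatAlong E kitX kitY) (hmono : kitX.Monotone) (hcof : CharOpenCofinal X) :
    CoFreeKernelCofinalAlong E kitX kitY := by
  intro H' hH'
  have hU : IsOpenFiniteIndexInDelta X (H'.comap E.f.toMonoidHom) :=
    E.isOpenFiniteIndexInDelta_comap hH'.1
  obtain ⟨H, hH, hHU⟩ := hcof _ hU
  refine ⟨H, hH, ?_⟩
  have hle : kitX.coFr H ≤ kitX.coFr (H'.comap E.f.toMonoidHom) := hmono H _ hH.1 hU hHU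
  have hmap : (kitX.coFr H).map (E.fHat.toMonoidHom.comp X.toHat.toMonoidHom) ≤
      (kitY.coFr H').map Y.toHat.toMonoidHom := by
    rw [← E.toHat_comp_eq, ← Subgroup.map_map, ← hcompat H' hH']
    exact Subgroup.map_mono (Subgroup.map_mono hle)
  exact Subgroup.topologicalClosure_mono hmap

end Literature.AnabelianGeometry.AbsoluteAnabelian.AbsTopI.Prop410
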